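import Summits.CriticalPhenomena.PercolationContinuityZ3.Theorems.SahiBoxTP2HilbertMarginals
import Summits.CriticalPhenomena.PercolationContinuityZ3.Theorems.SahiBoxTP2Positivity
import Summits.CriticalPhenomena.PercolationContinuityZ3.Theorems.SahiInfiniteVolumeContinuum

/-!
# Almost-everywhere-monotone images of `λ^ℕ` are Sahi-positive (given Lieb–Sahi's continuous case)

Support file of the Sahi cell (`prim-sahi`, typer seat, generation 12; `--supports stmt-CriticalPhenomena-4575`).
The analytic half of the Hilbert-cube theorem of `SahiBoxTP2HilbertPositivity.lean`.

* `msahiE_volume_nonneg_of_monotoneOn` — on the finite cube `Q_d`, `LiebSahiContinuum d n` controls every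
  nonnegative bounded family that is monotone on a set of FULL MEASURE (upper envelopes,
  `SahiBoxTP2Positivity.exists_monotone_ae_eq_of_monotoneOn`; no measurability needed).
* `msahiE_lebesgueHilbert_avg_nonneg` — on the Hilbert cube `ℕ → [0,1]` with `λ^ℕ = lebesgueHilbert`: the average
  `T_s h (ω) = ∫ h(s.piecewise ω η) dλ^ℕ(η)` of a bounded measurable family monotone on a measurable set `S'` of
  full measure is monotone on the set of `ω` almost all of whose gluings lie in `S'` — a measurable
  (`measurableSet_ae_piecewise_mem`), `s`-saturated set of full measure (Fubini through the tree's
  `infinitePi_prod_map_piecewise`, `ae_ae_piecewise_mem`) — and factors through the finite cube `↥s → [0,1]`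
  (as in `SahiInfiniteVolume.msahiE_infinitePi_unitInterval_nonneg_dependsOn`), so `E_n(T_s h) ≥ 0` given
  `LiebSahiContinuum |s| n`.
* `msahiE_lebesgueHilbert_nonneg_of_monotoneOn` — letting `s ↑ ℕ` (`SahiInfiniteVolume.tendsto_msahiE_avg`):
  **`(∀ d, LiebSahiContinuum d n)` ⟹ `E_n(h) ≥ 0` under `λ^ℕ` for every bounded measurable nonnegative family
  monotone on a set of full measure**, and `msahiE_map_lebesgueHilbert_nonneg_of_monotoneOn`: the same for
  monotone families under any a.e.-monotone measurable image `G_* λ^ℕ`.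

In infinite dimension the measurability hypotheses are essential (a free ultrafilter is a non-measurable up-set of
`{0,1}^ℕ`), which is why the repair of the null set is done on the finite-dimensional averages and not on the cube.
No sorries, no new axioms.
-/

noncomputable section

namespace Summit.CriticalPhenomena.PercolationContinuityZ3.Theorems.SahiBoxTP2

open MeasureTheory ProbabilityTheory Set Filter Topology Function Literature.Combinatorics.Sahi2008
open Literature.Probability.Percolation
open scoped ENNReal unitInterval

/-! ### The finite cube: families monotone almost everywhere -/

section Cube

variable {d n : ℕ}

/-- **A.e.-monotone families on `Q_d`**: if `LiebSahiContinuum d n` holds then `E_n(g_0,…,g_{n-1}) ≥ 0` under `λ_d`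
for every nonnegative bounded family monotone on a set of full measure (replace each `g_i` by its monotone upper
envelope, a.e. equal to it, `exists_monotone_ae_eq_of_monotoneOn`; no measurability needed). [this work] -/
theorem msahiE_volume_nonneg_of_monotoneOn (h : LiebSahiContinuum d n) (g : Fin n → (Fin d → I) → ℝ)
    {S : Set (Fin d → I)} (hS : ∀ᵐ x ∂(volume : Measure (Fin d → I)), x ∈ S) (hg : ∀ i, MonotoneOn (g i) S)
    (hg0 : ∀ i x, 0 ≤ g i x) {M : ℝ} (hgM : ∀ i x, g i x ≤ M) :
    0 ≤ msahiE (volume : Measure (Fin d → I)) n g := by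
  choose l hlmono hl0 hgl using fun i =>
    exists_monotone_ae_eq_of_monotoneOn (volume : Measure (Fin d → I)) hS (hg i) (hg0 i) (hgM i)
  rw [msahiE_congr_of_moments _ _ g l fun T => LebesgueCube.integral_prod_congr_ae hgl T]
  exact liebSahiContinuum_iff_mSahiPositive.1 h l hl0 hlmono

end Cube

/-! ### Cylinder averages of a.e.-monotone families on the Hilbert cube -/

section Cylinder

variable {n : ℕ}

/-- The averaging map `T_s h (ω) = ∫ h(s.piecewise ω η) dλ^ℕ(η)` of a bounded measurable `h` monotone on a set `S'`
is monotone on the set of `ω` almost all of whose gluings `s.piecewise ω η` lie in `S'`. [this work] -/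
theorem monotoneOn_integral_piecewise [DecidableEq ℕ] (s : Finset ℕ) {h : (ℕ → I) → ℝ} (hm : Measurable h)
    {C : ℝ} (hb : ∀ u, ‖h u‖ ≤ C) {S' : Set (ℕ → I)} (hmono : MonotoneOn h S') :
    MonotoneOn (fun ω => ∫ η, h (s.piecewise ω η) ∂lebesgueHilbert)
      {ω | ∀ᵐ η ∂lebesgueHilbert, s.piecewise ω η ∈ S'} := by
  intro ω hω ω' hω' hle
  refine integral_mono_ae (integrable_comp_piecewise (fun _ => volume) hm hb ω)
    (integrable_comp_piecewise (fun _ => volume) hm hb ω') ?_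
  filter_upwards [hω, hω'] with η h1 h2
  exact hmono h1 h2 (Finset.piecewise_le_piecewise _ hle le_rfl)

/-- **Almost every gluing lies in a set of full measure**: if `λ^ℕ(S'ᶜ) = 0` then for `λ^ℕ`-a.e. `ω`,
`s.piecewise ω η ∈ S'` for `λ^ℕ`-a.e. `η` (Fubini through `infinitePi_prod_map_piecewise`). [folklore] -/
theorem ae_ae_piecewise_mem [DecidableEq ℕ] (s : Finset ℕ) {S' : Set (ℕ → I)} (hS'm : MeasurableSet S')
    (hS' : ∀ᵐ u ∂lebesgueHilbert, u ∈ S') :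
    ∀ᵐ ω ∂lebesgueHilbert, ∀ᵐ η ∂lebesgueHilbert, s.piecewise ω η ∈ S' := by
  have hprod : ∀ᵐ p ∂(lebesgueHilbert.prod lebesgueHilbert), s.piecewise p.1 p.2 ∈ S' := by
    have h0 : (lebesgueHilbert.prod lebesgueHilbert) ((fun p : (ℕ → I) × (ℕ → I) => s.piecewise p.1 p.2) ⁻¹' S'ᶜ) = 0 := by
      rw [← Measure.map_apply (measurable_finsetPiecewise s) hS'm.compl,
        infinitePi_prod_map_piecewise (fun _ : ℕ => (volume : Measure I)) s]
      exact ae_iff.1 hS'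
    rw [ae_iff]
    exact h0
  exact Measure.ae_ae_of_ae_prod hprod

/-- The set of good `ω` is measurable (for measurable `S'`). [folklore] -/
theorem measurableSet_ae_piecewise_mem [DecidableEq ℕ] (s : Finset ℕ) {S' : Set (ℕ → I)} (hS'm : MeasurableSet S') :
    MeasurableSet {ω : ℕ → I | ∀ᵐ η ∂lebesgueHilbert, s.piecewise ω η ∈ S'} := by
  have hmeas : Measurable fun ω : ℕ → I =>
      lebesgueHilbert (Prod.mk ω ⁻¹' ((fun p : (ℕ → I) × (ℕ → I) => s.piecewise p.1 p.2) ⁻¹' S'ᶜ)) :=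
    measurable_measure_prodMk_left ((measurable_finsetPiecewise s) hS'm.compl)
  have hset : {ω : ℕ → I | ∀ᵐ η ∂lebesgueHilbert, s.piecewise ω η ∈ S'} =
      (fun ω : ℕ → I => lebesgueHilbert (Prod.mk ω ⁻¹' ((fun p : (ℕ → I) × (ℕ → I) => s.piecewise p.1 p.2) ⁻¹' S'ᶜ)))
        ⁻¹' {0} := by
    ext ω
    simp only [mem_setOf_eq, mem_preimage, mem_singleton_iff, ae_iff]
    rfl
  rw [hset]
  exact hmeas (measurableSet_singleton 0)

/-- **Cylinder averages of an a.e.-monotone family have `E_n ≥ 0`** (given `LiebSahiContinuum |s| n`): the averaged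
family factors through the finite cube `↥s → [0,1]` (as in `msahiE_infinitePi_unitInterval_nonneg_dependsOn`) as a
family monotone on a set of full `λ_{|s|}`-measure, to which `msahiE_volume_nonneg_of_monotoneOn` applies after
reindexing by `Fin |s|`. [this work] -/
theorem msahiE_lebesgueHilbert_avg_nonneg [DecidableEq ℕ] (s : Finset ℕ) (hL : LiebSahiContinuum s.card n)
    (h : Fin n → (ℕ → I) → ℝ) (hm : ∀ k, Measurable (h k)) (h0 : ∀ k u, 0 ≤ h k u) {C : ℝ} (hC : ∀ k u, h k u ≤ C)
    {S' : Set (ℕ → I)} (hS'm : MeasurableSet S') (hS' : ∀ᵐ u ∂lebesgueHilbert, u ∈ S')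
    (hmono : ∀ k, MonotoneOn (h k) S') :
    0 ≤ msahiE lebesgueHilbert n (fun k ω => ∫ η, h k (s.piecewise ω η) ∂lebesgueHilbert) := by
  have hb : ∀ k u, ‖h k u‖ ≤ C := fun k u => by
    rw [Real.norm_eq_abs, abs_of_nonneg (h0 k u)]; exact hC k u
  -- the good set of `ω`
  set A : Set (ℕ → I) := {ω | ∀ᵐ η ∂lebesgueHilbert, s.piecewise ω η ∈ S'} with hA
  have hAm : MeasurableSet A := measurableSet_ae_piecewise_mem s hS'm
  have hAae : ∀ᵐ ω ∂lebesgueHilbert, ω ∈ A := ae_ae_piecewise_mem s hS'm hS'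
  -- the averaged family
  set g : Fin n → (ℕ → I) → ℝ := fun k ω => ∫ η, h k (s.piecewise ω η) ∂lebesgueHilbert with hg
  have hgm : ∀ k, Measurable (g k) := fun k => measurable_integral_piecewise (fun _ => volume) (hm k)
  have hgmono : ∀ k, MonotoneOn (g k) A := fun k => monotoneOn_integral_piecewise s (hm k) (hb k) (hmono k)
  have hg0 : ∀ k ω, 0 ≤ g k ω := fun k ω => integral_nonneg fun η => h0 k _
  have hgC : ∀ k ω, g k ω ≤ C := fun k ω => by
    have h1 := norm_integral_piecewise_le (fun _ : ℕ => (volume : Measure I)) (s := s) (hb k) ω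
    rw [Real.norm_eq_abs] at h1
    exact (le_abs_self _).trans h1
  have hdep : ∀ k, DependsOn (g k) ↑s := fun k => dependsOn_integral_piecewise (fun _ => volume) (h k)
  -- factor through the finite cube `↥s → I`
  set G : Fin n → (↥s → I) → ℝ := fun k y => g k (updateFinset (fun _ => 1) s y) with hG_def
  have hfac : ∀ k ω, g k ω = G k (s.restrict ω) := fun k ω => by
    simp only [hG_def]
    exact hdep k fun i hi => by simp [updateFinset, Finset.mem_coe.1 hi]
  have hGm : ∀ k, Measurable (G k) := fun k => (hgm k).comp measurable_updateFinset
  have hG0 : ∀ k y, 0 ≤ G k y := fun k y => hg0 k _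
  have hGC : ∀ k y, G k y ≤ C := fun k y => hgC k _
  -- the good set on the finite cube
  set B : Set (↥s → I) := (updateFinset (fun _ : ℕ => (1 : I)) s) ⁻¹' A with hB
  have hBm : MeasurableSet B := measurable_updateFinset hAm
  have hupd_mono : Monotone (updateFinset (fun _ : ℕ => (1 : I)) s) := by
    intro y y' hy i
    by_cases hi : i ∈ s
    · simp only [updateFinset, dif_pos hi]; exact hy ⟨i, hi⟩
    · simp only [updateFinset, dif_neg hi]; exact le_rfl
  have hGmono : ∀ k, MonotoneOn (G k) B := fun k y hy y' hy' hyy' =>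
    hgmono k hy hy' (hupd_mono hyy')
  -- `B` has full measure: `A` is saturated along `s`
  have hsat : ∀ ω, ω ∈ A ↔ updateFinset (fun _ : ℕ => (1 : I)) s (s.restrict ω) ∈ A := by
    intro ω
    have hpw : ∀ η, s.piecewise (updateFinset (fun _ : ℕ => (1 : I)) s (s.restrict ω)) η = s.piecewise ω η := by
      intro η
      refine s.piecewise_congr (fun j hj => ?_) fun _ _ => rfl
      simp [updateFinset, hj]
    simp only [hA, mem_setOf_eq, hpw]
  have hBae : ∀ᵐ y ∂(Measure.pi fun _ : ↥s => (volume : Measure I)), y ∈ B := by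
    rw [← Measure.infinitePi_map_restrict (X := fun _ : ℕ => I) (μ := fun _ : ℕ => (volume : Measure I))]
    refine (ae_map_iff (μ := lebesgueHilbert) (f := (s.restrict : (ℕ → I) → (↥s → I)))
      (Finset.measurable_restrict s).aemeasurable (p := fun y : ↥s → I => y ∈ B) hBm).2 ?_
    filter_upwards [hAae] with ω hω
    exact (hsat ω).1 hω
  -- `E_n` under `λ^ℕ` of the cylinder family is `E_n` under the finite product measure
  have hmom : ∀ S : Finset (Fin n), ∫ ω, (∏ k ∈ S, g k) ω ∂lebesgueHilbert =
      ∫ y, (∏ k ∈ S, G k) y ∂Measure.pi (fun _ : ↥s => (volume : Measure I)) := by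
    intro S
    have e : (fun ω => (∏ k ∈ S, g k) ω) = fun ω => (∏ k ∈ S, G k) (s.restrict ω) := by
      funext ω
      simp only [Finset.prod_apply, hfac]
    have hmS : Measurable fun y : ↥s → I => (∏ k ∈ S, G k) y := by
      have e' : (fun y : ↥s → I => (∏ k ∈ S, G k) y) = fun y => ∏ k ∈ S, G k y :=
        funext fun y => Finset.prod_apply y S G
      rw [e']
      exact Finset.measurable_prod S fun k _ => hGm k
    rw [e, integral_restrict_infinitePi (fun _ : ℕ => (volume : Measure I)) hmS.aestronglyMeasurable]
  rw [msahiE_congr_of_moments lebesgueHilbert (Measure.pi fun _ : ↥s => (volume : Measure I)) g G hmom]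
  -- reindex `↥s ≃ Fin |s|`
  set e : Fin s.card ≃ ↥s := s.equivFin.symm with he
  have hmp := measurePreserving_piCongrLeft (α := fun _ : ↥s => I) (fun _ : ↥s => (volume : Measure I)) e
  rw [← msahiE_comp_measurePreserving hmp (MeasurableEquiv.piCongrLeft (fun _ : ↥s => I) e).measurableEmbedding
    n G]
  have hemono : Monotone (MeasurableEquiv.piCongrLeft (fun _ : ↥s => I) e) := by
    intro x x' hxx' a
    obtain ⟨b, rfl⟩ := e.surjective a
    rw [MeasurableEquiv.coe_piCongrLeft, Equiv.piCongrLeft_apply_apply, Equiv.piCongrLeft_apply_apply]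
    exact hxx' b
  have hBae' : ∀ᵐ x ∂(volume : Measure (Fin s.card → I)), MeasurableEquiv.piCongrLeft (fun _ : ↥s => I) e x ∈ B := by
    have h1 : ∀ᵐ y ∂(Measure.map (MeasurableEquiv.piCongrLeft (fun _ : ↥s => I) e)
        (volume : Measure (Fin s.card → I))), y ∈ B := by
      rw [show (volume : Measure (Fin s.card → I)) = Measure.pi (fun b : Fin s.card => (volume : Measure I)) from rfl,
        hmp.map_eq]
      exact hBae
    exact ae_of_ae_map hmp.measurable.aemeasurable h1
  exact msahiE_volume_nonneg_of_monotoneOn hL _ hBae'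
    (fun k x hx x' hx' hxx' => hGmono k hx hx' (hemono hxx')) (fun k x => hG0 k _) (fun k x => hGC k _)

end Cylinder

/-! ### A.e.-monotone images of `λ^ℕ` -/

section Image

variable {n : ℕ}

/-- **Families monotone almost everywhere on the Hilbert cube have `E_n ≥ 0` under `λ^ℕ`** (given
`LiebSahiContinuum d n` for every `d`): average over the coordinates outside a finite `s` (an a.e.-monotone cylinder
family, `msahiE_lebesgueHilbert_avg_nonneg`) and let `s ↑ ℕ` (`SahiInfiniteVolume.tendsto_msahiE_avg`). [this work] -/
theorem msahiE_lebesgueHilbert_nonneg_of_monotoneOn (hL : ∀ d, LiebSahiContinuum d n) (h : Fin n → (ℕ → I) → ℝ)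
    (hm : ∀ k, Measurable (h k)) (h0 : ∀ k u, 0 ≤ h k u) {C : ℝ} (hC : ∀ k u, h k u ≤ C) {S : Set (ℕ → I)}
    (hS : ∀ᵐ u ∂lebesgueHilbert, u ∈ S) (hmono : ∀ k, MonotoneOn (h k) S) : 0 ≤ msahiE lebesgueHilbert n h := by
  classical
  -- shrink the good set to a measurable one
  set S' : Set (ℕ → I) := (toMeasurable lebesgueHilbert {u | ¬ u ∈ S})ᶜ with hS'def
  have hS'm : MeasurableSet S' := (measurableSet_toMeasurable _ _).compl
  have hS'S : S' ⊆ S := fun u hu => by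
    by_contra hnot
    exact hu (subset_toMeasurable _ _ hnot)
  have hS' : ∀ᵐ u ∂lebesgueHilbert, u ∈ S' := by
    rw [ae_iff]
    have e : {u : ℕ → I | ¬ u ∈ S'} = toMeasurable lebesgueHilbert {u | ¬ u ∈ S} := by
      ext u; simp only [hS'def, mem_setOf_eq, mem_compl_iff, not_not]
    rw [e, measure_toMeasurable]
    exact ae_iff.1 hS
  have hmono' : ∀ k, MonotoneOn (h k) S' := fun k => (hmono k).mono hS'S
  have hb : ∀ k u, ‖h k u‖ ≤ C := fun k u => by
    rw [Real.norm_eq_abs, abs_of_nonneg (h0 k u)]; exact hC k u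
  refine ge_of_tendsto' (SahiInfiniteVolume.tendsto_msahiE_avg (fun _ : ℕ => (volume : Measure I)) h hm hb)
    fun s => ?_
  exact msahiE_lebesgueHilbert_avg_nonneg s (hL _) h hm h0 hC hS'm hS' hmono'

/-- **A.e.-monotone images of `λ^ℕ`**: if `G : (ℕ → [0,1]) → Ω` is measurable and monotone on a set of full
`λ^ℕ`-measure, then `E_n(f_0,…,f_{n-1}) ≥ 0` under `G_* λ^ℕ` for all bounded nonnegative monotone measurable
`f_i : Ω → ℝ` (given `LiebSahiContinuum d n` for every `d`). [this work] -/
theorem msahiE_map_lebesgueHilbert_nonneg_of_monotoneOn (hL : ∀ d, LiebSahiContinuum d n) {Ω : Type*}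
    [MeasurableSpace Ω] [Preorder Ω] {G : (ℕ → I) → Ω} (hGm : Measurable G) {S : Set (ℕ → I)}
    (hS : ∀ᵐ u ∂lebesgueHilbert, u ∈ S) (hG : MonotoneOn G S) (f : Fin n → Ω → ℝ) (hfm : ∀ i, Measurable (f i))
    (hf0 : ∀ i p, 0 ≤ f i p) {C : ℝ} (hfC : ∀ i p, f i p ≤ C) (hmono : ∀ i, Monotone (f i)) :
    0 ≤ msahiE (lebesgueHilbert.map G) n f := by
  have hmp : MeasurePreserving G lebesgueHilbert (lebesgueHilbert.map G) := ⟨hGm, rfl⟩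
  rw [← msahiE_comp_measurePreserving_of_measurable hmp n f hfm]
  exact msahiE_lebesgueHilbert_nonneg_of_monotoneOn hL (fun i => f i ∘ G) (fun i => (hfm i).comp hGm)
    (fun i u => hf0 i _) (fun i u => hfC i _) hS fun i u hu v hv huv => hmono i (hG hu hv huv)

end Image

end Summit.CriticalPhenomena.PercolationContinuityZ3.Theorems.SahiBoxTP2
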